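import Summits.Ventures.LatticeQCDFlow.Exactness.FlowSamplerVsReweighting
import HarnessLib

/-!
# Reweighting the exact chain's output to ANOTHER target is dominated by reweighting the flow draws
# directly: `σ²_{chain→w'}(f) ≥ σ²_{RW,w'}(f)` for every pair of targets and every observable

HONEST FRAMING: exact (Metropolis-corrected) sampling algorithms for lattice gauge theory;
figures of merit are autocorrelation/cost numbers at stated couplings and volumes; no
continuum-physics claim.  (SCALAR calibration rung S0-A: not a gauge result.)

Venture `LatticeQCDFlow` (cell pub-lqcd), topic `Exactness`; FANOUT row 2 (`s0-phi4`, FLOW arm).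
NEW WORK of the cell, a corollary of `FlowSamplerVsReweighting.imhOp_reweightVar_le_chainVar_of_sq`
(GEN-24 #1; nothing is cited as a fact; no definition).  A common use of a Monte Carlo stream at
coupling `w = e^{−S}` is MULTI-ENSEMBLE REWEIGHTING to a neighbouring coupling `w' = e^{−S'}`
(Ferrenberg–Swendsen 1988 NAMED): `Σ h(xᵢ) f(xᵢ)/Σ h(xᵢ)` with `h = w'/w` along the stream.  Along
the exact flow chain `imhOp μ w q̃` this has `N·variance → σ²_chain(u)/(Z'/Z)²` with the centred
`u = h·(f − m')`, `m' = E_{π'} f`; reweighting the SAME model draws directly to `w'` has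
`N·variance → σ²_{RW,w'}(f) = Z'⁻² ∫ (f − m')² w'²/q̃`.  Since `u² w²/q̃ = (f − m')² w'²/q̃`
pointwise, GEN-24 #1 applied to `u` gives

  **`Z'⁻² ∫ (f − m')² w'²/q̃ ≤ (2 τ_int(u) · (∫ u² w)/Z) / (Z'/Z)²`** for every such `f`

with a summable series for `u`: detouring through the accept/reject chain at `w` and reweighting its
output can never beat reweighting the raw flow draws, whatever the second target.

## What is proved (general `(X, μ)`; `w, q̃ > 0` measurable integrable, `∫ q̃ = 1`)

* **`imhOp_chainReweightVar_ge_directReweightVar_of_sq`** — for measurable `w' ≥ 0` and `f`, any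
  real `m'`, with `u = (w'/w)(f − m')` square-integrable against `w` and a summable series along
  `imhOp μ w q̃`: `(f − m')² w' (w'/q̃) ∈ L¹` and the displayed inequality;
* **`imhOp_chainVar_ge_two_reweightVar_sub_var_of_sq`** — THE CHAIN PAYS AT LEAST TWICE THE
  REWEIGHTING EXCESS: `2σ²_RW(g) − Var_π(g) ≤ σ²_chain(g)` for every `g ∈ L²(w)` with a summable series
  (sharper than #1 whenever `σ²_RW > Var`; attained on two-level flows by weight-blind observables).

NOT CLAIMED: the choice `m' = E_{π'} f` (any real `m'` is allowed; the variance reading needs that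
one); finite-`N` bias of either ratio estimator; that the chain's configurations are not useful for
other purposes; values for any run.
-/

namespace Summit.Ventures.LatticeQCDFlow.Exactness

open Real MeasureTheory Filter Set
open Summit.Ventures.LatticeQCDFlow.Scoring

variable {X : Type*} [MeasurableSpace X] {μ : Measure X} [SFinite μ] {w q : X → ℝ}

/-- **CHAIN-THEN-REWEIGHT IS DOMINATED BY DIRECT REWEIGHTING.**  `w, q̃ > 0` measurable integrable,
`∫ q̃ = 1`; a second weight `w' ≥ 0` measurable, an observable `f` measurable, a constant `m'`; put
`u = (w'/w)·(f − m')`.  If `u ∈ L²(w)` and the series of `u` along `imhOp μ w q̃` is summable, then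
`(f − m')² · (w'/q̃) · w' ∈ L¹` and
`(∫ (f − m')² (w'/q̃) w') / Z'² ≤ (2 τ_int(u) · (∫ u² w)/Z) / (Z'/Z)²` (`Z = ∫ w`, `Z' = ∫ w' > 0`). -/
theorem imhOp_chainReweightVar_ge_directReweightVar_of_sq (hw0 : ∀ t, 0 < w t) (hwm : Measurable w)
    (hwi : Integrable w μ) (hq0 : ∀ t, 0 < q t) (hqm : Measurable q) (hqi : Integrable q μ)
    (hq1 : ∫ z, q z ∂μ = 1) {w' f : X → ℝ} (hw'm : Measurable w') (hfm : Measurable f) (m' : ℝ)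
    (hZ' : 0 < ∫ z, w' z ∂μ)
    (hu2 : Integrable (fun t => (w' t / w t * (f t - m')) ^ 2 * w t) μ)
    (hs : Summable fun n => (∫ x, (w' x / w x * (f x - m'))
        * ((imhOp μ w q)^[n + 1] (fun t => w' t / w t * (f t - m'))) x * w x ∂μ)
      / ∫ x, (w' x / w x * (f x - m')) ^ 2 * w x ∂μ) :
    Integrable (fun x => (f x - m') ^ 2 * (w' x / q x * w' x)) μ ∧
    (∫ x, (f x - m') ^ 2 * (w' x / q x * w' x) ∂μ) / (∫ z, w' z ∂μ) ^ 2
      ≤ (2 * tauInt (fun n => (∫ x, (w' x / w x * (f x - m'))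
            * ((imhOp μ w q)^[n] (fun t => w' t / w t * (f t - m'))) x * w x ∂μ)
            / ∫ x, (w' x / w x * (f x - m')) ^ 2 * w x ∂μ)
          * ((∫ x, (w' x / w x * (f x - m')) ^ 2 * w x ∂μ) / ∫ z, w z ∂μ))
        / ((∫ z, w' z ∂μ) / ∫ z, w z ∂μ) ^ 2 := by
  have hum : Measurable fun t => w' t / w t * (f t - m') := (hw'm.div hwm).mul (hfm.sub measurable_const)
  obtain ⟨hint, hle⟩ := imhOp_reweightVar_le_chainVar_of_sq hw0 hwm hwi hq0 hqm hqi hq1 hum hu2 hs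
  have hZ : 0 < ∫ z, w z ∂μ := integral_pos_of_pos hw0 hwi hq1
  -- pointwise identity `u² (w/q̃) w = (f − m')² (w'/q̃) w'`
  have e : (fun x => (w' x / w x * (f x - m')) ^ 2 * (w x / q x * w x))
      = fun x => (f x - m') ^ 2 * (w' x / q x * w' x) := by
    funext x
    have hw := (hw0 x).ne'
    have hq := (hq0 x).ne'
    field_simp
  rw [e] at hint hle
  refine ⟨hint, ?_⟩
  -- divide GEN-24 #1's inequality (stated with `Z²`) by `(Z'/Z)²`
  set A := ∫ x, (f x - m') ^ 2 * (w' x / q x * w' x) ∂μ with hA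
  set R := 2 * tauInt (fun n => (∫ x, (w' x / w x * (f x - m'))
      * ((imhOp μ w q)^[n] (fun t => w' t / w t * (f t - m'))) x * w x ∂μ)
      / ∫ x, (w' x / w x * (f x - m')) ^ 2 * w x ∂μ)
    * ((∫ x, (w' x / w x * (f x - m')) ^ 2 * w x ∂μ) / ∫ z, w z ∂μ) with hR
  set Z := ∫ z, w z ∂μ with hZdef
  set Z' := ∫ z, w' z ∂μ with hZ'def
  have h1 : A ≤ R * Z ^ 2 := (div_le_iff₀ (pow_pos hZ 2)).1 hle
  rw [div_le_div_iff₀ (pow_pos hZ' 2) (pow_pos (div_pos hZ' hZ) 2)]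
  have e2 : R * Z' ^ 2 = R * Z ^ 2 * (Z' / Z) ^ 2 := by
    field_simp
  rw [e2]
  exact mul_le_mul_of_nonneg_right h1 (sq_nonneg _)

/-- **THE CHAIN PAYS AT LEAST TWICE THE REWEIGHTING EXCESS**: for every measurable `g ∈ L²(w)` with
`∫ g² w > 0` and a summable series, `2·σ²_RW(g) − Var_π(g) ≤ σ²_chain(g)`, i.e.
`2·Z⁻²∫ g² b w − (∫ g² w)/Z ≤ 2 τ_int(g)·(∫ g² w)/Z` — GEN-24 #1's `τ_int ≥ E_{g²}[max(1, b/Z)] − ½`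
with `max(1, b/Z) ≥ b/Z`.  Sharper than `σ²_RW ≤ σ²_chain` exactly when `σ²_RW > Var` (the usual
case: a flow worse than i.i.d. sampling for that observable); attained on two-level flows by
weight-blind observables (GEN-24 #9 and its sequel: `σ²_chain = (2 − κ)σ²_RW` there). -/
theorem imhOp_chainVar_ge_two_reweightVar_sub_var_of_sq (hw0 : ∀ t, 0 < w t) (hwm : Measurable w)
    (hwi : Integrable w μ) (hq0 : ∀ t, 0 < q t) (hqm : Measurable q) (hqi : Integrable q μ)
    (hq1 : ∫ z, q z ∂μ = 1) {g : X → ℝ} (hgm : Measurable g)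
    (hg2 : Integrable (fun t => g t ^ 2 * w t) μ) (hP : 0 < ∫ x, g x ^ 2 * w x ∂μ)
    (hs : Summable fun n => (∫ x, g x * ((imhOp μ w q)^[n + 1] g) x * w x ∂μ)
      / ∫ x, g x ^ 2 * w x ∂μ) :
    2 * ((∫ x, g x ^ 2 * (w x / q x * w x) ∂μ) / (∫ z, w z ∂μ) ^ 2)
        - (∫ x, g x ^ 2 * w x ∂μ) / (∫ z, w z ∂μ)
      ≤ 2 * tauInt (fun n => (∫ x, g x * ((imhOp μ w q)^[n] g) x * w x ∂μ)
            / ∫ x, g x ^ 2 * w x ∂μ) * ((∫ x, g x ^ 2 * w x ∂μ) / ∫ z, w z ∂μ) := by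
  obtain ⟨hint, -⟩ := integral_sq_weight_maxWeight_le_of_sq hw0 hwm hwi hq0 hqm hqi hq1 hgm hg2 hs
  obtain ⟨hbw, -⟩ := imhOp_reweightVar_le_chainVar_of_sq hw0 hwm hwi hq0 hqm hqi hq1 hgm hg2 hs
  have hτ := imhOp_tauInt_ge_maxWeightMean_of_sq hw0 hwm hwi hq0 hqm hqi hq1 hgm hg2 hs
  set Z : ℝ := ∫ z, w z ∂μ with hZdef
  set A := ∫ x, g x ^ 2 * w x ∂μ with hA
  set τ := tauInt (fun n => (∫ x, g x * ((imhOp μ w q)^[n] g) x * w x ∂μ) / A) with hτdef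
  have hZ : 0 < Z := integral_pos_of_pos hw0 hwi hq1
  -- `∫ g² b w = Z · ∫ g² w (b/Z) ≤ Z · ∫ g² w max(1, b/Z)`
  have h1 : ∫ x, g x ^ 2 * (w x / q x * w x) ∂μ ≤ Z * ∫ x, g x ^ 2 * w x * max 1 (w x / q x / Z) ∂μ := by
    rw [← integral_const_mul]
    refine integral_mono hbw (hint.const_mul Z) fun x => ?_
    have hgw : 0 ≤ g x ^ 2 * w x := mul_nonneg (sq_nonneg _) (hw0 x).le
    have e : g x ^ 2 * (w x / q x * w x) = Z * (g x ^ 2 * w x * (w x / q x / Z)) := by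
      field_simp
    rw [e]
    exact mul_le_mul_of_nonneg_left (mul_le_mul_of_nonneg_left (le_max_right _ _) hgw) hZ.le
  -- `E_{g²}[max] ≤ τ + ½`
  have h2 : (∫ x, g x ^ 2 * w x * max 1 (w x / q x / Z) ∂μ) ≤ (τ + 1 / 2) * A := by
    have := (div_le_iff₀ hP).1 (by linarith [hτ] : (∫ x, g x ^ 2 * w x * max 1 (w x / q x / Z) ∂μ) / A
      ≤ τ + 1 / 2)
    linarith
  -- assemble: `2 B/Z² − A/Z ≤ 2τ A/Z` with `B ≤ Z (τ + ½) A`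
  have h3 : ∫ x, g x ^ 2 * (w x / q x * w x) ∂μ ≤ Z * ((τ + 1 / 2) * A) :=
    h1.trans (mul_le_mul_of_nonneg_left h2 hZ.le)
  have e1 : 2 * ((Z * ((τ + 1 / 2) * A)) / Z ^ 2) - A / Z = 2 * τ * (A / Z) := by
    field_simp
    ring
  have h4 : 2 * ((∫ x, g x ^ 2 * (w x / q x * w x) ∂μ) / Z ^ 2) ≤ 2 * ((Z * ((τ + 1 / 2) * A)) / Z ^ 2) :=
    mul_le_mul_of_nonneg_left (div_le_div_of_nonneg_right h3 (pow_pos hZ 2).le) (by norm_num)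
  linarith [h4, e1]

end Summit.Ventures.LatticeQCDFlow.Exactness
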